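import Summits.CriticalPhenomena.PercolationContinuityZ3.Theorems.Transplant.TriFilmSKTerms
import HarnessLib

/-!
# Triangular film `𝕋 × {0,1}`, VI: a COVER BIT IS A SWAP PAIR — soundness of `CtxT.coverOf`

builds on p205010 (kernel theorem, internal audit signed; external expert review pending) — NOT used in this file.  Lane `prim-bschramm`, seat
`prim-bschramm-p2` (gen 39; class C1b; memo `HOME/bschramm/P2-LATTICES.md` §138); helper file (`--supports stmt-CriticalPhenomena-4575 --as helper`).
«Slab111SK4Plan» for the triangular films: if the bit `w` is set in `C.coverOf e₁ e₂ c₁ y b c₂ avoid` («TriFilmSKDefs»), then the certified-terminal triple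
`(vtxT e₁, vtxT e₂, vtxT w)` admits a SWAP PAIR of routings `r₁, r₂ : VRouteData (film k) (WsetT ∩ \overline{blkR 3 z t_R s_R}) WsetT` («HexShadowVRouteData»)
with `r₁.y = r₂.b = vtxT y`, `r₁.b = r₂.y = vtxT b`:
* §1 **`routing_sound`** (one re-validated routing + reachability gives a `VRouteData` via «VPathKit».`VRouteData.ofPaths`); §2 **`coverOf_sound`**.
[cite: DuminilCopinSidoraviciusTassion2016, §2.3 (proof of Fact 2: γ_u, γ_v, γ_w and "(z,v) ≺ (z,w)")]
-/

noncomputable section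

namespace Summit.CriticalPhenomena.PercolationContinuityZ3.Theorems.Transplant

open Literature.Probability.Percolation Literature.Probability.LatticeModels SimpleGraph
open scoped Classical

namespace TriFilm.SKT

open Slab111.SK (mem_ne_ends eq_dropLast_append_of_getLast? eq_cons_tail_of_head? of_testBit_cond_not of_testBit_match_option bitOf sdiff maskBelow maskOfList endsOK orFold rd rdMask testBit_bitOf testBit_sdiff testBit_maskBelow of_testBit_maskBelow testBit_maskBelow_of testBit_maskOfList testBit_maskOfList_eq_false endsOK_sound)

variable {C : CtxT} {z : Site 2}

/-! ## §1 One routing -/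

/-- **ONE RE-VALIDATED ROUTING WITH A REACHABLE BRANCH TARGET IS A `VRouteData`.**  Route `e₁ ⇝ c → t ⇝ e₂` (index lists `A` from `e₁` to `c` inside
`WR ∪ {e₁, c}`, `T` from `t` to `e₂` inside `(WR ∪ {e₂}) ∖ A`), branch from `o ∼ c` to `w` by reachability in `W` off the route.
[cite: DuminilCopinSidoraviciusTassion2016, §2.3 (proof of Fact 2: γ_u, γ_v, γ_w)] -/
theorem routing_sound {tR sR : ℕ} (htR : C.tR = min tR 3) (hsR : C.sR = min sR 3)
    (hWv : ∀ i, C.W.testBit i = true → C.validB i = true) {e1 e2 c t o w : ℕ} {A T : List ℕ}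
    (hv1 : C.validB e1 = true) (hne : e1 ≠ e2) (hWR2 : C.WR.testBit e2 = true)
    (hc : c = e1 ∨ C.WR.testBit c = true) (ho : C.WR.testBit o = true) (hct : adjBT c t = true) (hco : adjBT c o = true)
    (hA : pathOKT (C.WR ||| bitOf e1 ||| bitOf c) A 0 = true) (hAe : endsOK A e1 c = true)
    (hT : pathOKT (sdiff (C.WR ||| bitOf e2) (maskOfList A)) T 0 = true) (hTe : endsOK T t e2 = true)
    (hg : (reachT C.univ (sdiff C.W (maskOfList A ||| maskOfList T)) (bitOf o)).testBit w = true) :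
    ∃ r : VRouteData (film C.k) (WsetT C z ∩ (hexShadow C.k).lift (blkR 3 z tR sR)) (WsetT C z) (vtxT C.k z e1) (vtxT C.k z e2) (vtxT C.k z w),
      r.y = vtxT C.k z t ∧ r.b = vtxT C.k z o := by
  have hWRv : ∀ {i}, C.WR.testBit i = true → C.validB i = true := fun h => hWv _ ((testBit_WR_iff C _).1 h).1
  have hv2 := hWRv hWR2
  have hvc : C.validB c = true := by rcases hc with rfl | hc; exact hv1; exact hWRv hc
  have hvo := hWRv ho
  obtain ⟨hAch, hAnd, hAmem⟩ := pathOKT_sound _ A 0 hA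
  obtain ⟨hTch, hTnd, hTmem⟩ := pathOKT_sound _ T 0 hT
  obtain ⟨hAh, hAl⟩ := endsOK_sound hAe
  obtain ⟨hTh, hTl⟩ := endsOK_sound hTe
  -- membership facts
  have hAin : ∀ x ∈ A, C.WR.testBit x = true ∨ x = e1 ∨ x = c := by
    intro x hx
    have := (hAmem x hx).1
    simp only [Nat.testBit_lor, testBit_bitOf, Bool.or_eq_true, decide_eq_true_eq] at this
    rcases this with (h | h) | h
    · exact Or.inl h
    · exact Or.inr (Or.inl h.symm)
    · exact Or.inr (Or.inr h.symm)
  have hTin : ∀ x ∈ T, (C.WR.testBit x = true ∨ x = e2) ∧ x ∉ A := by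
    intro x hx
    have := (hTmem x hx).1
    rw [testBit_sdiff, Bool.and_eq_true, Nat.testBit_lor, Bool.or_eq_true, testBit_bitOf, Bool.not_eq_true',
      testBit_maskOfList_eq_false] at this
    simp only [decide_eq_true_eq] at this
    rcases this with ⟨h | h, hnA⟩
    · exact ⟨Or.inl h, hnA⟩
    · exact ⟨Or.inr h.symm, hnA⟩
  have hAv : ∀ x ∈ A, C.validB x = true := by
    intro x hx; rcases hAin x hx with h | rfl | rfl
    · exact hWRv h
    · exact hv1
    · exact hvc
  have hTv : ∀ x ∈ T, C.validB x = true := by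
    intro x hx; rcases (hTin x hx).1 with h | rfl
    · exact hWRv h
    · exact hv2
  -- the route as one index list
  set SP := A ++ T with hSPdef
  have hSPv : ∀ x ∈ SP, C.validB x = true := by
    intro x hx; rcases List.mem_append.1 hx with hx | hx; exact hAv x hx; exact hTv x hx
  have hSPch : SP.IsChain AdjRelT := by
    rw [hSPdef, List.isChain_append]
    refine ⟨hAch, hTch, fun x hx y hy => ?_⟩
    rw [hAl, Option.mem_def, Option.some.injEq] at hx
    rw [hTh, Option.mem_def, Option.some.injEq] at hy
    subst hx hy; exact adjBT_iff.1 hct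
  have hSPnd : SP.Nodup := by
    rw [hSPdef, List.nodup_append]
    exact ⟨hAnd, hTnd, fun x hx y hy hxy => (hTin y hy).2 (hxy ▸ hx)⟩
  have hSPh : SP.head? = some e1 := by rw [hSPdef, List.head?_append, hAh]; rfl
  have hSPl : SP.getLast? = some e2 := by rw [hSPdef, List.getLast?_append, hTl]; rfl
  have hGP := gpath_of_idx' (z := z) hSPv hSPch hSPnd hSPh hSPl
  -- interior in the rerouting set
  have hint : ∀ x ∈ (SP.map (vtxT C.k z)).tail.dropLast, x ∈ WsetT C z ∩ (hexShadow C.k).lift (blkR 3 z tR sR) := by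
    intro x hx
    obtain ⟨hxm, hx1, hx2⟩ := mem_ne_ends hGP.nodup hGP.head hGP.last hx
    obtain ⟨j, hj, rfl⟩ := List.mem_map.1 hxm
    have hjv := hSPv j hj
    rw [← testBit_WR_iff_mem hjv htR hsR]
    rcases List.mem_append.1 hj with hjA | hjT
    · rcases hAin j hjA with h | rfl | rfl
      · exact h
      · exact absurd rfl hx1
      · rcases hc with rfl | h
        · exact absurd rfl hx1
        · exact h
    · rcases (hTin j hjT).1 with h | rfl
      · exact h
      · exact absurd rfl hx2
  -- the edge `c → t` on the route
  have hcy : ∃ l₁ l₂ : List (triFilm C.k), SP.map (vtxT C.k z) = l₁ ++ vtxT C.k z c :: vtxT C.k z t :: l₂ := by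
    refine ⟨A.dropLast.map (vtxT C.k z), T.tail.map (vtxT C.k z), ?_⟩
    rw [hSPdef, eq_dropLast_append_of_getLast? hAl, eq_cons_tail_of_head? hTh]
    simp
  -- the branch
  have hRv : ∀ i, (sdiff C.W (maskOfList A ||| maskOfList T)).testBit i = true → C.validB i = true := by
    intro i hi
    rw [testBit_sdiff, Bool.and_eq_true] at hi
    exact hWv i hi.1
  obtain ⟨Br, hBr, hBrR⟩ := exists_branch_of_reach (z := z) hRv hg
  have hBrW : ∀ x ∈ Br, x ∈ WsetT C z := by
    intro x hx
    obtain ⟨j, hjv, hjR, rfl⟩ := hBrR x hx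
    rw [testBit_sdiff, Bool.and_eq_true] at hjR
    exact (vtx_mem_Wset_iff hjv).2 hjR.1
  have hoff : ∀ x ∈ Br, x ∉ SP.map (vtxT C.k z) := by
    intro x hx hxSP
    obtain ⟨j, hjv, hjR, rfl⟩ := hBrR x hx
    rw [testBit_sdiff, Bool.and_eq_true, Nat.testBit_lor, Bool.not_eq_true', Bool.or_eq_false_iff, testBit_maskOfList_eq_false,
      testBit_maskOfList_eq_false] at hjR
    have hj := (mem_map_vtx_iff hSPv hjv).1 hxSP
    rcases List.mem_append.1 hj with h | h
    · exact hjR.2.1 h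
    · exact hjR.2.2 h
  have hcb : (film C.k).Adj (vtxT C.k z c) (vtxT C.k z o) := adj_vtx hvc hvo (adjBT_iff.1 hco)
  have hneV : vtxT C.k z e1 ≠ vtxT C.k z e2 := fun h => hne (vtx_inj hv1 hv2 h)
  exact ⟨VRouteData.ofPaths hGP hneV hint hcy hBr hBrW hcb hoff, VRouteData.ofPaths_y hGP hneV hint hcy hBr hBrW hcb hoff,
    VRouteData.ofPaths_b hGP hneV hint hcy hBr hBrW hcb hoff⟩

/-! ## §2 Soundness of `coverOf` -/

/-- **A COVER BIT IS A SWAP PAIR.**  [cite: DuminilCopinSidoraviciusTassion2016, §2.3 (proof of Fact 2: γ_u, γ_v, γ_w and "(z,v) ≺ (z,w)")] -/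
theorem coverOf_sound {tR sR : ℕ} (htR : C.tR = min tR 3) (hsR : C.sR = min sR 3)
    (hWv : ∀ i, C.W.testBit i = true → C.validB i = true) {e1 e2 w c1 y b c2 av : ℕ}
    (h : (C.coverOf e1 e2 c1 y b c2 av).testBit w = true) :
    ∃ r₁ r₂ : VRouteData (film C.k) (WsetT C z ∩ (hexShadow C.k).lift (blkR 3 z tR sR)) (WsetT C z) (vtxT C.k z e1) (vtxT C.k z e2) (vtxT C.k z w),
      r₁.y = r₂.b ∧ r₁.b = r₂.y := by
  unfold CtxT.coverOf at h
  try dsimp only at h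
  obtain ⟨hst, h⟩ := of_testBit_cond_not h
  -- the static conditions
  simp only [Bool.and_eq_true, Bool.or_eq_true, bne_iff_ne, ne_eq, beq_iff_eq] at hst
  obtain ⟨⟨⟨⟨⟨⟨⟨⟨⟨⟨⟨⟨⟨⟨⟨⟨⟨⟨⟨⟨⟨⟨⟨⟨⟨hne, hyb⟩, hye1⟩, hbe1⟩, hbe2⟩, hc1e2⟩, hc2e2⟩, hye2⟩, hc1⟩, hc2⟩, hyR⟩, hbR⟩, hbW⟩, hc1y⟩, hc1b⟩, hc2y⟩, hc2b⟩,
    hc1ney⟩, hc1neb⟩, hc2ney⟩, hc2neb⟩, hu1⟩, hu2⟩, hWR1⟩, hWR2⟩, hav⟩ := hst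
  have hv1 : C.validB e1 = true := (testBit_univ_iff C e1).1 hu1
  -- routing 1
  obtain ⟨A, hAeq, h⟩ := of_testBit_match_option h
  try dsimp only at h
  obtain ⟨Y, hYeq, h⟩ := of_testBit_match_option h
  try dsimp only at h
  obtain ⟨hval1, h⟩ := of_testBit_cond_not h
  simp only [Bool.and_eq_true] at hval1
  obtain ⟨⟨⟨hA, hAe⟩, hY⟩, hYe⟩ := hval1
  -- routing 2
  obtain ⟨A2, hA2eq, h⟩ := of_testBit_match_option h
  try dsimp only at h
  obtain ⟨B, hBeq, h⟩ := of_testBit_match_option h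
  try dsimp only at h
  obtain ⟨hval2, h⟩ := of_testBit_cond_not h
  simp only [Bool.and_eq_true] at hval2
  obtain ⟨⟨⟨hA2, hA2e⟩, hB⟩, hBe⟩ := hval2
  rw [Nat.testBit_land, Bool.and_eq_true] at h
  obtain ⟨hg1, hg2⟩ := h
  have hc1' : c1 = e1 ∨ C.WR.testBit c1 = true := by rcases hc1 with h | h; exact Or.inl h; exact Or.inr h
  have hc2' : c2 = e1 ∨ C.WR.testBit c2 = true := by rcases hc2 with h | h; exact Or.inl h; exact Or.inr h
  obtain ⟨r₁, hr₁y, hr₁b⟩ := routing_sound (z := z) htR hsR hWv hv1 hne hWR2 hc1' hbR hc1y hc1b hA hAe hY hYe hg1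
  obtain ⟨r₂, hr₂y, hr₂b⟩ := routing_sound (z := z) htR hsR hWv hv1 hne hWR2 hc2' hyR hc2b hc2y hA2 hA2e hB hBe hg2
  exact ⟨r₁, r₂, by rw [hr₁y, hr₂b], by rw [hr₁b, hr₂y]⟩

end TriFilm.SKT

end Summit.CriticalPhenomena.PercolationContinuityZ3.Theorems.Transplant

end
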